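import Literature.NumberTheory.Automorphic.GaloisActionPlaces
import Mathlib.FieldTheory.IsAlgClosed.AlgebraicClosure
import Mathlib.FieldTheory.Galois.Basic
import Mathlib.RingTheory.Frobenius
import HarnessLib

/-!
# Transport of extensions of a number field `K` along an automorphism of `K`
# ("conjugate extensions": degree, Galois group, primes and Frobenius elements)

Topic `NumberTheory/NumberFields`.  Theorem-only file (no definition, no named fact).

Let `τ` be an automorphism of a number field `K` and let `e : E ≃ E'` be a ring isomorphism of
two extensions of `K` which is `τ`-semilinear, `e(a·y) = τ(a)·e(y)` — the situation of two
**conjugate extensions** `E'= g(E)` of `K` inside an algebraic closure, `g` an automorphism of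
`K̄` with `g|_K = τ` (Neukirch, *Algebraic Number Theory*, Ch. I §9, "conjugate prime ideals":
`σ𝔓 ∩ K = σ(𝔓 ∩ K)`, and the Frobenius of `σ𝔓` is `σ Frob_𝔓 σ⁻¹`).  Everything that is
intrinsic to the pair `(K ⊆ E)` transports to `(K ⊆ E')` once the base is moved by `τ`:

* `exists_conjHom_of_semilinear` — the injective homomorphism `σ ↦ e σ e⁻¹`,
  `Gal(E/K) → Gal(E'/K)` (the conjugate of a `K`-automorphism is again `K`-linear because
  `τ(K) = K`);
* `under_map_of_semilinear` — for a prime `𝔔` of `𝓞_E`: `e(𝔔) ∩ 𝓞_K = τ(𝔔 ∩ 𝓞_K)`;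
* `isArithFrobAt_map_of_semilinear` — if `σ` is an arithmetic Frobenius of `E/K` at `𝔔`, then
  `e σ e⁻¹` is an arithmetic Frobenius of `E'/K` at `e(𝔔)`;
* inside `K̄ = AlgebraicClosure K` for `K/ℚ` Galois and `g ∈ Aut(K̄/ℚ)`:
  `exists_intermediateField_conj` (the conjugate `g(E)` as an intermediate field of `K̄/K`,
  `x ∈ g(E) ↔ g⁻¹ x ∈ E`), `exists_ringEquiv_conj` (the `g|_K`-semilinear `E ≃ g(E)`),
  `finrank_conj`, `finiteDimensional_conj`, `isGalois_conj` (`[g(E):K] = [E:K]`, and `g(E)/K`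
  is Galois when `E/K` is: `#Aut_K(g(E)) ≥ #Aut_K(E) = [E:K]`).

Used for the functoriality of class fields under `Aut(K/ℚ)` (the cubic class fields of a
quadratic field are normal over `ℚ`: `Literature/NumberTheory/QuadraticFields/…`, Scholz's
reflection theorem).

## References

* J. Neukirch, *Algebraic Number Theory*, Grundlehren 322 (1999), Ch. I §9 (conjugate prime
  ideals, p. 55–56). [NeukirchANT1999]
-/

noncomputable section

open NumberField

namespace Literature.NumberTheory.NumberFields

/-! ### Semilinear isomorphisms of extensions: automorphisms, primes, Frobenius -/

section Semilinear

variable {K : Type*} [Field K] {E E' : Type*} [Field E] [Field E'] [Algebra K E] [Algebra K E']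
  (τ : K ≃+* K) (e : E ≃+* E') (heK : ∀ x, e (algebraMap K E x) = algebraMap K E' (τ x))

include heK in
/-- The inverse of a `τ`-semilinear isomorphism is `τ⁻¹`-semilinear. [folklore] -/
theorem symm_algebraMap_of_semilinear (x : K) :
    e.symm (algebraMap K E' x) = algebraMap K E (τ.symm x) := by
  apply e.injective
  rw [e.apply_symm_apply, heK, τ.apply_symm_apply]

include heK in
/-- **Conjugation of `K`-automorphisms along a semilinear isomorphism.**  For a `τ`-semilinear
ring isomorphism `e : E ≃ E'` (`τ ∈ Aut K`) the map `σ ↦ e σ e⁻¹` is an injective group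
homomorphism `Gal(E/K) → Gal(E'/K)` (Neukirch I §9: conjugate extensions have conjugate
groups). [cite: NeukirchANT1999, Ch. I §9] -/
theorem exists_conjHom_of_semilinear :
    ∃ c : (E ≃ₐ[K] E) →* (E' ≃ₐ[K] E'), Function.Injective c ∧
      ∀ (σ : E ≃ₐ[K] E) (y : E), c σ (e y) = e (σ y) := by
  -- the conjugate as a `K`-algebra automorphism
  have hcomm : ∀ (σ : E ≃ₐ[K] E) (x : K),
      (e.symm.trans (σ.toRingEquiv.trans e)) (algebraMap K E' x) = algebraMap K E' x := by
    intro σ x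
    rw [RingEquiv.trans_apply, RingEquiv.trans_apply, symm_algebraMap_of_semilinear τ e heK,
      AlgEquiv.coe_ringEquiv, AlgEquiv.commutes, heK, τ.apply_symm_apply]
  let c₀ : (E ≃ₐ[K] E) → (E' ≃ₐ[K] E') := fun σ =>
    AlgEquiv.ofRingEquiv (f := e.symm.trans (σ.toRingEquiv.trans e)) (hcomm σ)
  have hc₀ : ∀ σ y', c₀ σ y' = e (σ (e.symm y')) := fun σ y' => rfl
  refine ⟨{ toFun := c₀, map_one' := ?_, map_mul' := ?_ }, ?_, ?_⟩
  · ext y'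
    rw [hc₀, AlgEquiv.one_apply, AlgEquiv.one_apply, e.apply_symm_apply]
  · intro σ₁ σ₂
    ext y'
    rw [hc₀, AlgEquiv.mul_apply, AlgEquiv.mul_apply, hc₀, hc₀, e.symm_apply_apply]
  · intro σ₁ σ₂ h
    ext y
    have := congrArg (fun f : E' ≃ₐ[K] E' => e.symm (f (e y))) h
    simpa only [MonoidHom.coe_mk, OneHom.coe_mk, hc₀, e.symm_apply_apply] using this
  · intro σ y
    change c₀ σ (e y) = e (σ y)
    rw [hc₀, e.symm_apply_apply]

include heK in
/-- On rings of integers the isomorphism `𝓞(e)` is semilinear over `𝓞(τ)`. [folklore] -/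
theorem mapRingEquiv_algebraMap_of_semilinear (x : 𝓞 K) :
    RingOfIntegers.mapRingEquiv e (algebraMap (𝓞 K) (𝓞 E) x) =
      algebraMap (𝓞 K) (𝓞 E') (RingOfIntegers.mapRingEquiv τ x) := by
  apply RingOfIntegers.ext
  rw [RingOfIntegers.mapRingEquiv_apply]
  change e (algebraMap K E (x : K)) = algebraMap K E' ((RingOfIntegers.mapRingEquiv τ x : 𝓞 K) : K)
  rw [RingOfIntegers.mapRingEquiv_apply, heK]

include heK in
/-- **Conjugate primes lie over conjugate primes**: for an ideal `𝔔` of `𝓞_E`,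
`e(𝔔) ∩ 𝓞_K = τ(𝔔 ∩ 𝓞_K)` (Neukirch I §9). [cite: NeukirchANT1999, Ch. I §9] -/
theorem under_map_of_semilinear (Q : Ideal (𝓞 E)) :
    (Q.map (RingOfIntegers.mapRingEquiv e)).under (𝓞 K) =
      (Q.under (𝓞 K)).map (RingOfIntegers.mapRingEquiv τ) := by
  ext x
  rw [Ideal.under, Ideal.mem_comap, ← Ideal.comap_symm, Ideal.mem_comap,
    ← Ideal.comap_symm, Ideal.mem_comap, Ideal.under, Ideal.mem_comap]
  have h : (RingOfIntegers.mapRingEquiv e).symm (algebraMap (𝓞 K) (𝓞 E') x) =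
      algebraMap (𝓞 K) (𝓞 E) ((RingOfIntegers.mapRingEquiv τ).symm x) := by
    apply (RingOfIntegers.mapRingEquiv e).injective
    rw [RingEquiv.apply_symm_apply, mapRingEquiv_algebraMap_of_semilinear τ e heK,
      RingEquiv.apply_symm_apply]
  change (RingOfIntegers.mapRingEquiv e).symm (algebraMap (𝓞 K) (𝓞 E') x) ∈ Q ↔
    algebraMap (𝓞 K) (𝓞 E) ((RingOfIntegers.mapRingEquiv τ).symm x) ∈ Q
  rw [h]

include heK in
/-- The conjugate of a prime of `E` above `𝔭` is a prime of `E'` above `τ(𝔭)`. [folklore] -/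
theorem map_mem_primesOver_of_semilinear {p : Ideal (𝓞 K)} {Q : Ideal (𝓞 E)}
    (hQ : Q ∈ p.primesOver (𝓞 E)) :
    Q.map (RingOfIntegers.mapRingEquiv e) ∈
      (p.map (RingOfIntegers.mapRingEquiv τ)).primesOver (𝓞 E') := by
  haveI := hQ.1
  refine ⟨Ideal.map_isPrime_of_equiv _, ⟨?_⟩⟩
  rw [under_map_of_semilinear τ e heK, ← hQ.2.over]

include heK in
/-- **Conjugate Frobenius** (Neukirch I §9: the Frobenius of `σ𝔓` is `σ Frob_𝔓 σ⁻¹`): if `σ` is an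
arithmetic Frobenius of `E/K` at the prime `𝔔`, and `σ'` is its conjugate (`σ' ∘ e = e ∘ σ`), then
`σ'` is an arithmetic Frobenius of `E'/K` at `e(𝔔)` (the residue fields of `𝔔 ∩ 𝓞_K` and
`τ(𝔔 ∩ 𝓞_K)` have the same cardinality). [cite: NeukirchANT1999, Ch. I §9] -/
theorem isArithFrobAt_map_of_semilinear (σ : E ≃ₐ[K] E) (σ' : E' ≃ₐ[K] E')
    (hσ : ∀ y, σ' (e y) = e (σ y)) {Q : Ideal (𝓞 E)} (hQ : IsArithFrobAt (𝓞 K) σ Q) :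
    IsArithFrobAt (𝓞 K) σ' (Q.map (RingOfIntegers.mapRingEquiv e)) := by
  intro x'
  have hcard : Nat.card (𝓞 K ⧸ (Q.map (RingOfIntegers.mapRingEquiv e)).under (𝓞 K)) =
      Nat.card (𝓞 K ⧸ Q.under (𝓞 K)) := by
    rw [under_map_of_semilinear τ e heK Q]
    exact (Nat.card_congr (Ideal.quotientEquiv (Q.under (𝓞 K)) _
      (RingOfIntegers.mapRingEquiv τ) rfl).toEquiv).symm
  rw [hcard, MulSemiringAction.toAlgHom_apply]
  obtain ⟨x, rfl⟩ := (RingOfIntegers.mapRingEquiv e).surjective x'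
  have h1 := hQ x
  rw [MulSemiringAction.toAlgHom_apply] at h1
  have h2 := Ideal.mem_map_of_mem (RingOfIntegers.mapRingEquiv e) h1
  rw [map_sub, map_pow] at h2
  convert h2 using 2
  apply RingOfIntegers.ext
  rw [RingOfIntegers.mapRingEquiv_apply]
  change σ' ((RingOfIntegers.mapRingEquiv e x : 𝓞 E') : E') = e ((σ • x : 𝓞 E) : E)
  rw [RingOfIntegers.mapRingEquiv_apply, hσ]
  rfl

end Semilinear

/-! ### Conjugates of an intermediate field of `K̄/K` by `Aut(K̄/ℚ)` -/

section Conj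

variable {K : Type} [Field K] [NumberField K] [IsGalois ℚ K]

/-- **The conjugate `g(E)`** of an intermediate field `E` of `K̄/K` by a `ℚ`-automorphism `g` of
`K̄ = AlgebraicClosure K` is again an intermediate field of `K̄/K` (since `K/ℚ` is normal,
`g(K) = K`), with `x ∈ g(E) ↔ g⁻¹(x) ∈ E`. [folklore] -/
theorem exists_intermediateField_conj (g : AlgebraicClosure K ≃ₐ[ℚ] AlgebraicClosure K)
    (E : IntermediateField K (AlgebraicClosure K)) :
    ∃ E' : IntermediateField K (AlgebraicClosure K), ∀ x, x ∈ E' ↔ g.symm x ∈ E := by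
  let E₀ : IntermediateField ℚ (AlgebraicClosure K) :=
    (E.restrictScalars ℚ).map (g : AlgebraicClosure K →ₐ[ℚ] AlgebraicClosure K)
  have hmem : ∀ x, x ∈ E₀ ↔ g.symm x ∈ E := by
    intro x
    simp only [E₀, IntermediateField.mem_map, IntermediateField.mem_restrictScalars,
      AlgEquiv.coe_toAlgHom]
    constructor
    · rintro ⟨y, hy, rfl⟩
      rwa [g.symm_apply_apply]
    · intro hx
      exact ⟨g.symm x, hx, g.apply_symm_apply x⟩
  have halg : ∀ x : K, algebraMap K (AlgebraicClosure K) x ∈ E₀.toSubfield := by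
    intro x
    change algebraMap K (AlgebraicClosure K) x ∈ E₀
    rw [hmem, ← AlgEquiv.restrictNormal_commutes g.symm K]
    exact E.algebraMap_mem _
  refine ⟨E₀.toSubfield.toIntermediateField halg, fun x => ?_⟩
  change x ∈ E₀ ↔ _
  exact hmem x

variable {g : AlgebraicClosure K ≃ₐ[ℚ] AlgebraicClosure K}
  {E E' : IntermediateField K (AlgebraicClosure K)} (hE' : ∀ x, x ∈ E' ↔ g.symm x ∈ E)

include hE' in
/-- The conjugate `g(E)` is `g|_K`-semilinearly ring-isomorphic to `E` (restriction of `g`).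
[folklore] -/
theorem exists_ringEquiv_conj :
    ∃ e : E ≃+* E', (∀ y : E, ((e y : E') : AlgebraicClosure K) = g y) ∧
      ∀ x : K, e (algebraMap K E x) = algebraMap K E' (g.restrictNormal K x) := by
  have h1 : ∀ y : E, g y ∈ E' := fun y => (hE' _).mpr (by rw [g.symm_apply_apply]; exact y.2)
  have h2 : ∀ y' : E', g.symm y' ∈ E := fun y' => (hE' _).mp y'.2
  let e : E ≃+* E' :=
    { toFun := fun y => ⟨g y, h1 y⟩
      invFun := fun y' => ⟨g.symm y', h2 y'⟩
      left_inv := fun y => Subtype.ext (g.symm_apply_apply _)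
      right_inv := fun y' => Subtype.ext (g.apply_symm_apply _)
      map_mul' := fun a b => Subtype.ext (by
        change g ((a : AlgebraicClosure K) * b) = g a * g b
        rw [map_mul])
      map_add' := fun a b => Subtype.ext (by
        change g ((a : AlgebraicClosure K) + b) = g a + g b
        rw [map_add]) }
  refine ⟨e, fun y => rfl, fun x => Subtype.ext ?_⟩
  change g (algebraMap K (AlgebraicClosure K) x) =
    algebraMap K (AlgebraicClosure K) (g.restrictNormal K x)
  rw [AlgEquiv.restrictNormal_commutes]

include hE' in
/-- **Conjugate extensions have the same degree**: `[g(E) : K] = [E : K]` (both sides of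
`[E:ℚ] = [E:K][K:ℚ]`, and `g : E ≃ g(E)` is `ℚ`-linear). [folklore] -/
theorem finrank_conj : Module.finrank K E' = Module.finrank K E := by
  obtain ⟨e, -, -⟩ := exists_ringEquiv_conj hE'
  let f : E ≃ₗ[ℚ] E' :=
    { (e : E ≃+ E') with map_smul' := fun q x => map_rat_smul (e : E ≃+ E') q x }
  have hQ : Module.finrank ℚ E = Module.finrank ℚ E' := LinearEquiv.finrank_eq f
  have hE : Module.finrank ℚ K * Module.finrank K E = Module.finrank ℚ E :=
    Module.finrank_mul_finrank ℚ K E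
  have hE'' : Module.finrank ℚ K * Module.finrank K E' = Module.finrank ℚ E' :=
    Module.finrank_mul_finrank ℚ K E'
  have hK : 0 < Module.finrank ℚ K := Module.finrank_pos
  apply Nat.eq_of_mul_eq_mul_left hK
  rw [hE'', hE, hQ]

include hE' in
/-- The conjugate of a finite extension is finite. [folklore] -/
theorem finiteDimensional_conj [FiniteDimensional K E] : FiniteDimensional K E' :=
  Module.finite_of_finrank_pos (by rw [finrank_conj hE']; exact Module.finrank_pos)

include hE' in
/-- **The conjugate of a Galois extension of `K` is Galois over `K`**: conjugation by `g` embeds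
`Aut_K(E)` into `Aut_K(g(E))`, so `#Aut_K(g(E)) ≥ [E:K] = [g(E):K]`. [folklore] -/
theorem isGalois_conj [FiniteDimensional K E] [IsGalois K E] : IsGalois K E' := by
  haveI : FiniteDimensional K E' := finiteDimensional_conj hE'
  obtain ⟨e, -, heK⟩ := exists_ringEquiv_conj hE'
  obtain ⟨c, hc, -⟩ := exists_conjHom_of_semilinear (g.restrictNormal K).toRingEquiv e heK
  apply IsGalois.of_card_aut_eq_finrank
  apply le_antisymm
  · rw [Nat.card_eq_fintype_card]
    exact AlgEquiv.card_le
  · rw [finrank_conj hE', ← IsGalois.card_aut_eq_finrank]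
    exact Nat.card_le_card_of_injective c hc

end Conj

end Literature.NumberTheory.NumberFields

end
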